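import Summits.BirchSwinnertonDyer.Rank1Residual.O5.O5CompanionTransport
import Literature.NumberTheory.EllipticCurves.Selmer
import HarnessLib

/-!
# O5 — GEN 5: the LOCAL KUMMER LINE at the tame `e = 4` prime `3` — T18 (`KummerLineCanonicalThreeStar`,
# THEOREM-CANDIDATE with proof), the 3-adically DECIDABLE shadow of L3 / T17 (`KummerTorsorsAgreeAtThree`),
# L3-irr / its intrinsic form T19 `KummerLineUniversalThree` (CONJECTURES) and T17 `CleanSelmerTransferThree`
# (CONJECTURE), with the census instruments VELU3 / KUM3LOC

Add-on to `O5CompanionTransport` (G3: `numStableLinesAtThree`, `IsCompanionAtThree`, `NonSplitAtThreeLaw`; p263520)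
and `O5OldLine` (T15′/T16, p270063).  Census cell O5 = (t′), o5-r1 GEN 5 (planner-b2b-bsdres-o5-r1-g5-0, 2026-08-21).
HONEST FRAMING: every node is a `def … : Prop` (THEOREM-CANDIDATE, proof written in `HOME/cells/o5o6/TARGETS.md`
§O5 '#### o5-r1 GEN 5' G5-1 with its printed inputs) or an `@[conjecture] def` (research crux / census law);
nothing is asserted, nothing booked; census numbers are EVIDENCE; no main conjecture and no BSD formula is an input
of anything below (the instruments use division polynomials and 3-adic factorisation only).

## Why this file (TARGETS §O5 G4-8 (d), cc-typer-5 TYPED.md §8)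
T17 `CleanSelmerTransferThree` (Sel₃(W) = Sel₃(G) for a clean congruent pair, `G` good at `3`) reduces, by
Poitou–Tate bookkeeping away from `3`, to the LOCAL statement L3: the Kummer line `κ_W := im(W(ℚ₃)/3 → H¹(ℚ₃, W[3]))`
of the additive curve `W` corresponds, under the `G_{ℚ₃}`-isomorphism `W[3] ≅ G[3]` (unique up to `±1`:
`End_{G_{ℚ₃}} ρ̄ = 𝔽₃` for irreducible or non-split `ρ̄`), to the Kummer (= flat) line `κ_G` of the good curve `G`.
No printed Kummer-image result covers additive potentially-good reduction at `p` with `e ≥ p − 1` (Mazur–Rubin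
arXiv:1203.0620 Thm 3.1 (iv); Česnavičius arXiv:1301.4724 Thm 1.1: semiabelian at `v ∣ p`).  GEN 5 supplies
(1) the vocabulary making L3 a statement about POLYNOMIALS over `ℚ₃` (so census-decidable and prover-attackable);
(2) T18: L3 PROVED on the reducible-local rows (52 889 of the 77 415 III* rows `N < 5·10⁵`), with the census VELU3;
(3) L3-irr, the residual conjecture on the `LocIrr` rows, with the census KUM3LOC; (3′) its INTRINSIC sharpening T19
`KummerLineUniversalThree` — ONE local flat-supersingular class `V₀` at `3` (T19a `SupersingularLocalClassUniqueThree`,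
derived) and the Kummer line of every III* `LocIrr` curve is the flat line `ℓ₀ ⊂ H¹(ℚ₃, V₀)`, tested against UNRELATED
supersingular curves (KUM3LOC P-K7); (4) T17 typed over `selmerGroup`.

## §0 Dictionary: Kummer classes ↔ nine-point torsors ↔ `Λ_P` (derivation (a)/(b) of `gen5/KUM3LOC-PREREG.md`)
For `P ∈ E(ℚ₃)` not 2-torsion, `T_P := [3]⁻¹P ⊂ E(ℚ̄₃)` is an `E[3]`-torsor with class `κ(P)`, and `Q ↦ x(Q)` is a
`G_{ℚ₃}`-equivariant bijection of `T_P` onto the 9 roots of `Λ_P(X) := φ₃(X) − x(P)·ψ₃(X)² = X·Ψ₃² − preΨ₄·Ψ₂Sq − x(P)·Ψ₃²`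
(`−Q ∉ T_P`).  If `ρ̄ := E[3]|G_{ℚ₃}` has `H⁰ = 0` and is irreducible or non-split, then `H¹(ℚ₃(ρ̄)/ℚ₃, ρ̄) = 0`
(order prime to 3, resp. `H¹(U, V)^{T} = (V/C ⊗ U^∨)^T = 0` as the stable line's character is non-trivial), so a
class is determined up to `𝔽₃^×` by the `G_{ℚ₃}`-SET `T_P`, i.e. by the Galois theory of `Λ_P` over `ℚ₃`:
(a) `ρ̄` irreducible (`|im| ∈ {8,16}` prime to 3): `Λ_P` is irreducible of degree 9 when `P ∉ 3E(ℚ₃)`, and two curves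
`W, X` with isomorphic `ρ̄` have the same Kummer line iff `Λ^X` has a root in `ℚ₃[X]/(Λ^W)`;
(b) `ρ̄` non-split with stable line `C`: `κ(P) ∈ L_C := im H¹(ℚ₃, C)` iff some coset `Q + C ⊂ T_P` is `G_{ℚ₃}`-stable
iff `Λ_P` has an irreducible CUBIC factor; the pattern is then `[3,6]` if `ρ̄/C ≠ 𝟙` and `[3,3,3]` if `ρ̄/C = 𝟙`,
and `[9]` otherwise.  (PARI: `factorpadic`, exact on exact input.)

## TYPER PLACEMENT NOTE (cc-typer-5 GEN 6, typer of record O5 §3.5, 2026-08-21)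

HONEST FRAMING (cell `b2b-bsdres`, run/shared/lean/b2b/bsd-rank1-residual/, verbatim in every
file): the goal of the cell is to DELETE the COMBINATION-SHAPED residual classes of the
Birch–Swinnerton-Dyer formula for ALL analytic-rank `≤ 1` elliptic curves over `ℚ` — assembled
STRICTLY from published theorems — so that the rank-`≤ 1` remainder becomes exactly the
CONSTRUCTION-SHAPED classes, which are TYPED (missing-input `Prop`s), NOT attempted. This is not
"finishing BSD". Lane CLASS-CLOSURE (`CLASS-CLOSURE-PLAN.md` §3.5 O5): research routes; no claim beyond
the stated classes; census output is EVIDENCE / conjecture items, never a Literature fact; nothing is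
booked; no mark of `RESIDUAL-MAP.md` moves. NO Literature fact is minted here.

PROVENANCE. The module text above this note and every declaration below are o5-r1 GEN 5's freeze
`HOME/b2b-bsdres-o5-r1/gen5/O5KummerLine.lean` (sha16 `4eff6b94b84e8079`, 315 lines) VERBATIM (typing ask
A-O5-17, `HOME/INBOX.md` 2026-08-21T15:22Z / P.S. 15:26Z; `cells/o5o6/TARGETS.md` §O5 '#### o5-r1 GEN 5';
farm `lean check` rc 0, 0 warnings, 0 sorries), with TWO additions: the `@[conjecture]` tag on the five THEOREM-CANDIDATE nodes (lane ruling, below) and the E86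
tree-fact pointers appended to T17 `CleanSelmerTransferThree` (o5-r1 P.S. 15:26Z: "please add the E86
tree-fact pointers to the T17 docstring on landing"; harvest-2 GEN 39, E86, INBOX 14:45Z). Statements
byte-identical to the freeze. This resolves the HELD item "T17 / L3" of `class-closure/O5/TYPED.md` §8–§9.

READING OF THE DECLARATIONS (audit classes as in `O5OldLine.lean` / `O5CompanionTransport.lean`).
Definitions with bodies: `kummerNinePolyThree`, `tateFormThree`. Predicates (census-decidable, over
`ℚ_[3][X]`): `IsKummerBasePointThree`, `HasIrredFactorOfDegree₃`, `StableLineNonCyclotomicThree`,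
`KummerTorsorsAgreeAtThree`, `NoLocalThreeTorsionAt`, `SameDivisionQuarticAtThree`. THEOREM-CANDIDATES
(closed `def : Prop`, proof written in TARGETS §O5 G5-1 / G5-4 from printed inputs, NOT yet
kernel-checked, NOT asserted, NOT Literature facts): T18 `KummerLineCanonicalThreeStar`, T18′
`KummerLineRamifiedQuotientThree`, T18″ `KummerLineTransferReducibleThree`, T18‴
`KummerLineSplitMultDifferThree` (and T19a `SupersingularLocalClassUniqueThree` until 2026-08-22: PROVED, tag RETIRED — see its docstring) carry the
`@[conjecture]` TAG as well, by the lane lead's ruling (cc-lead GEN 22, INBOX 2026-08-21T15:37:56Z (8b):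
"`@[conjecture]` on every closed unproved `def : Prop` INCLUDING the T18 family (THEOREM-CANDIDATE wording
in the docstring)"): the tag marks an OPEN OBLIGATION NODE of the cell until a kernel proof lands, it does
not demote the written proofs; the docstrings keep o5-r1's THEOREM-CANDIDATE wording verbatim. Genuine
research conjectures (EVIDENCE-labelled conjecture items of the cell, OPEN): L3-irr
`KummerLineTransferLocIrrThree`, T19 `KummerLineUniversalThree`, T17 `CleanSelmerTransferThree`. Theorems: `kummerTorsorsAgree_of_cases`
(bookkeeping over the four hypotheses), and the two KERNEL `decide` lemmas `isotropicLine_unique_off_line`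
/ `isotropic_card_zero_or_four` (the 𝔽₃ linear algebra of T18; no axioms beyond the standard three).
The `[evidence: …]` tags carry the census numbers of TARGETS G5-2 as the planner wrote them; every
`[cite: …]` key exists in `references.bib` (checked: Schaefer1996, Katz1973, Lubin1979,
MazurRubin2015SelmerCompanions, Cesnavicius2016SelmerFlat, PoonenRains2012, Silverman1994, Serre1972,
ConradDiamondTaylor1999, Savitt2005). DEDUP: `lean search` for the new names → no match. 0 Literature
facts; net debt 0; nothing booked; no mark of `RESIDUAL-MAP.md` moves.

AMENDMENT (cc-typer-5 GEN 7, 2026-08-21; DOC-ONLY, statements byte-identical, tags unchanged — cc-lead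
⟦gen23⟧ (8)(c)): o5-r1 GEN 5's proof sketch `HOME/b2b-bsdres-o5-r1/gen5/T19-PROOF-SKETCH.md` was CHECKED
R1–R4 ✓ at the page by harvest-2 GEN 41, E88 `HOME/b2b-bsdres-harvest-2/gen41/E88-T19-check.md` (sha16
dd2e75e9c5f73320), which also DERIVED the flat-member lemma FML-local (§6.2) closing the one gap between
the sketch and the typed T19. The docstrings of L3-irr, T19a and T19 below now carry the written proof
with locators (THEOREM-CANDIDATE wording); the `@[conjecture]` tags stay until a KERNEL proof. The
pre-registered P-K10 torsor-discriminant law (III* ↦ 9, III ↦ 15; 0/154 810) is typed in `O5/O5TorsorDiscriminant.lean`.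
AMENDMENT 2 (cc-typer-5 GEN 8, DOC-ONLY, A-O5-18 (c)): T19a ← v2 Thm 2 (E90 R5 ✓); `LocalShapeTprimeThree` is a THEOREM (`O5.localShapeTprimeThree_holds`, E89; feeds `hshape` §4).
-/

open scoped Classical

open Polynomial WeierstrassCurve Literature.NumberTheory.EllipticCurves
  Summit.BirchSwinnertonDyer.Rank1Residual.Additive

namespace Summit.BirchSwinnertonDyer.Rank1Residual.O5

/-! ## §1 Vocabulary (polynomial, census-decidable) -/

/-- The **Kummer nine-polynomial** `Λ_x := Φ₃ − x·Ψ₃²` of `W` over `ℚ₃` at the abscissa `x`: its roots are the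
`x`-coordinates of the nine points `Q` with `3Q = P`, `x(P) = x`. [folklore] -/
noncomputable def kummerNinePolyThree (W : WeierstrassCurve ℚ) (x : ℚ_[3]) : ℚ_[3][X] :=
  (W.baseChange ℚ_[3]).Φ 3 - C x * (W.baseChange ℚ_[3]).Ψ₃ ^ 2

/-- `(x, y)` is an admissible **Kummer base point** of `W` at `3`: a `ℚ₃`-point of `W`, not 2-torsion, and NOT in
`3·W(ℚ₃)` — equivalently (for a non-2-torsion point) `Λ_x` has no root in `ℚ₃`.  When `W(ℚ₃)[3] = 0` the group
`W(ℚ₃) ⊗ 𝔽₃` is a line, so any admissible point generates it and the statements below do not depend on the choice.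
Census recipe (KUM3LOC `addx`/`semx`): additive `W` — an integral point reducing to a non-singular affine point
(`∈ W⁰(ℚ₃) ∖ W¹(ℚ₃)`, `c₃ = 2`); good `W` — a formal-group point with `v₃(x) = −2`, or a lift of a point of order
divisible by 3 when `3 ∣ #W̃(𝔽₃)`. [folklore] -/
def IsKummerBasePointThree (W : WeierstrassCurve ℚ) (x y : ℚ_[3]) : Prop :=
  (W.baseChange ℚ_[3]).toAffine.Equation x y ∧
    2 * y + (W.baseChange ℚ_[3]).a₁ * x + (W.baseChange ℚ_[3]).a₃ ≠ 0 ∧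
      ∀ r : ℚ_[3], ¬ (kummerNinePolyThree W x).IsRoot r

/-- `f ∈ ℚ₃[X]` has an irreducible factor of degree `d`. [folklore] -/
def HasIrredFactorOfDegree₃ (f : ℚ_[3][X]) (d : ℕ) : Prop :=
  ∃ q : ℚ_[3][X], Irreducible q ∧ q.natDegree = d ∧ q ∣ f

/-- The **class of the stable line is `ω·u`, `u ≠ 1`** ("lineclass 11" of the census): the `ℚ₃`-root `x₀` of `Ψ₃`
(the stable line `C = {0, ±(x₀, y₀)}`) has `Ψ₂²(x₀) = (2y₀ + a₁x₀ + a₃)² ∈ 3·(ℚ₃ˣ)²`, i.e. `ℚ₃(C) = ℚ₃(√3)`, so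
`C ≅ ω ⊗ u` with `u` the unramified quadratic character and `ρ̄/C ≅ u ≠ 𝟙`.  The other ramified class,
`Ψ₂²(x₀) ∈ −3·(ℚ₃ˣ)²` ("lineclass 12"), is `C ≅ ω = μ₃`, `ρ̄/C = 𝟙` (anomalous / split-multiplicative companions). [folklore] -/
def StableLineNonCyclotomicThree (W : WeierstrassCurve ℚ) : Prop :=
  ∃ x₀ s : ℚ_[3], (W.baseChange ℚ_[3]).Ψ₃.IsRoot x₀ ∧ s ≠ 0 ∧ ((W.baseChange ℚ_[3]).Ψ₂Sq).eval x₀ = 3 * s ^ 2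

/-- **The Kummer torsors of `W` and `X` at `3` agree** (base abscissae `x`, `x'`): the decidable shadow of
"`κ_W = κ_X` under the `G_{ℚ₃}`-isomorphism `W[3] ≅ X[3]`" for `ρ̄` irreducible or non-split with `H⁰ = 0` (§0):
the cubic-factor property is shared, and when `Λ^W` is irreducible, `Λ^X` acquires a root in the nonic field
`ℚ₃[X]/(Λ^W)`.  (For `[3,6]/[3,6]` both lines equal `L_C`; for `[9]/[9]` the root condition is equality of the
splitting fields `ℚ₃(W[3], T_{P_W}) = ℚ₃(X[3], T_{P_X})`.) [folklore] -/
def KummerTorsorsAgreeAtThree (W X : WeierstrassCurve ℚ) (x x' : ℚ_[3]) : Prop :=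
  (HasIrredFactorOfDegree₃ (kummerNinePolyThree W x) 3 ↔ HasIrredFactorOfDegree₃ (kummerNinePolyThree X x') 3) ∧
    (Irreducible (kummerNinePolyThree W x) →
      ∃ θ : AdjoinRoot (kummerNinePolyThree W x), aeval θ (kummerNinePolyThree X x') = 0)

/-- **No `ℚ_ℓ`-rational 3-torsion**: `H⁰(ℚ_ℓ, W[3]) = 0`, as the polynomial condition "no `ℚ_ℓ`-root `x₀` of `Ψ₃`
with `Ψ₂²(x₀)` a square in `ℚ_ℓ`".  For `ℓ ≠ 3` and self-dual `ρ̄` this is equivalent to `H¹(ℚ_ℓ, ρ̄) = 0`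
(`h¹ = h⁰ + h²`, `h² = h⁰` by local duality) — the CLEAN condition of TARGETS §O5 G4-8 (b). [folklore] -/
def NoLocalThreeTorsionAt (W : WeierstrassCurve ℚ) (ℓ : ℕ) [Fact ℓ.Prime] : Prop :=
  ∀ x₀ s : ℚ_[ℓ], (W.baseChange ℚ_[ℓ]).Ψ₃.IsRoot x₀ → ((W.baseChange ℚ_[ℓ]).Ψ₂Sq).eval x₀ = s ^ 2 → False

/-! ## §2 T18 — the Kummer line on the REDUCIBLE-local rows (THEOREM-CANDIDATE; = L3 there) -/

/-- **T18 `KummerLineCanonicalThreeStar` (THEOREM-CANDIDATE, o5-r1 GEN 5; proof: TARGETS §O5 G5-1).**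
For an O5b curve `W` of Kodaira type III* at `3` whose `W[3]|G_{ℚ₃}` is reducible (one stable line `C`,
`NonSplitAtThreeLaw`) and any admissible base point: **`κ_W = L_C` iff `ρ̄/C ≠ 𝟙`**, i.e. `Λ_P` has a cubic factor
iff the stable line has class `ω·u`, `u ≠ 1`; and for `ρ̄/C = 𝟙`, `κ_W ⊄ L_C` (`Λ_P` irreducible).
PROOF (G5-1): over `F = ℚ₃(3^{1/4})` the good model is supersingular with BROKEN Newton polygon of `[3]`, `C` = the
Katz–Lubin canonical subgroup, `φ : W → W' := W/C` has `v₃(φ^*ω'/ω) = 1` on minimal models and `W'` is of type III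
(`12 − 9`; Lubin's quotient formula + Néron integrality; VELU3 checks `(v₃Δ', a(φ)) = (3, 1)` on 52 889 / 52 889 rows);
Schaefer's local index formula `#coker(φ̂ : W'(ℚ₃) → W(ℚ₃)) = 3^{a(φ̂)}·#W'(ℚ₃)[φ̂]·c₃(W)/c₃(W')` with `a(φ̂) = 0`,
`W'[φ̂] ≅ ρ̄/C`, `c₃(III) = c₃(III*) = 2` gives `#coker φ̂ = #(ρ̄/C)(ℚ₃)`; and `κ_W ⊂ L_C ⟺ coker φ̂ = 0` because
`φ_* ∘ δ₃ = δ_{φ̂}` identifies the image of `κ_W` in `H¹(ℚ₃, ρ̄/C) = H¹(ℚ₃, W'[φ̂])` with `δ_{φ̂}(coker φ̂)`.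
CENSUS (EVIDENCE, KUM3LOC v1.0 full run kit j132978, pre-registered P-K1'/P-K2, frozen scorer): `[3,6]` on 25 665 / 25 665
class-11 III* rows; `[9]` with unramified coset character on 27 224 / 27 224 class-12 III* rows; 0 exceptions.
[cite: Schaefer1996, Lemma 3.8 (arXiv:1507.08324 p. 9)] [cite: Katz1973, Thm. 3.10.7] [cite: Lubin1979, Thm. A (§2, existence: v(a₁) < p/(p+1)) and Thm. B (§4, the quotient)]
[evidence: census cell O5, o5-r1 GEN 5: VELU3 105 778/105 778 isogeny rows; KUM3LOC j132978 singles 52 889/52 889 III* reducible rows as predicted] -/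
@[conjecture] def KummerLineCanonicalThreeStar : Prop :=
  ∀ (W : WeierstrassCurve ℚ) [W.IsElliptic] [W.IsGloballyMinimal],
    ClassO5 W 3 → SubTprime W 3 → numStableLinesAtThree W = 1 → padicValRat 3 W.Δ = 9 →
      ∀ x y : ℚ_[3], IsKummerBasePointThree W x y →
        (HasIrredFactorOfDegree₃ (kummerNinePolyThree W x) 3 ↔ StableLineNonCyclotomicThree W)

/-- **T18′ `KummerLineRamifiedQuotientThree` (THEOREM-CANDIDATE; the type-III half).**  For an O5b curve of
Kodaira type III at `3` with reducible `W[3]|G_{ℚ₃}` and NO `ℚ₃`-rational 3-torsion (stable line `C` UNRAMIFIED of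
class `u ≠ 1`, "lineclass 02", quotient `ω·u`; the class-01 rows, `C ≅ 𝟙`, have `W(ℚ₃)[3] ≠ 0`, a 2-dimensional
`W(ℚ₃)/3` and are excluded), `κ_W ∩ L_C = 0`: `Λ_P` has no cubic factor (is irreducible).
Proof: Schaefer's formula for `φ : W → W' = W/C` (`a(φ) = 0` as `W` is of type III, so `a(φ̂) = 1`; `c₃ = 2` both
sides; `W'[φ̂] ≅ ρ̄/C ≅ ωu` has no `ℚ₃`-points) gives `#coker φ̂ = 3`, and `φ_* ∘ δ₃ = δ_{φ̂}` as in T18, so the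
image of the line `κ_W` in `H¹(ℚ₃, ρ̄/C)` is non-zero.
CENSUS (EVIDENCE, KUM3LOC j132978 singles P-K1', class-02 type-III rows): `[9]` on 25 665 / 25 665.
[cite: Schaefer1996, Lemma 3.8 (arXiv:1507.08324 p. 9)] [evidence: census cell O5, o5-r1 GEN 5, KUM3LOC j132978: 25 665/25 665] -/
@[conjecture] def KummerLineRamifiedQuotientThree : Prop :=
  ∀ (W : WeierstrassCurve ℚ) [W.IsElliptic] [W.IsGloballyMinimal],
    ClassO5 W 3 → SubTprime W 3 → numStableLinesAtThree W = 1 → padicValRat 3 W.Δ = 3 →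
    NoLocalThreeTorsionAt W 3 →
      ∀ x y : ℚ_[3], IsKummerBasePointThree W x y → ¬ HasIrredFactorOfDegree₃ (kummerNinePolyThree W x) 3

/-- **T18″ `KummerLineTransferReducibleThree` (THEOREM-CANDIDATE; = T17-local on the reducible rows).**  For a
III* O5b curve `W` with irreducible `ρ̄_{W,3}` but reducible `W[3]|G_{ℚ₃}` and a GOOD (hence ordinary) companion
`G`: the Kummer torsors agree.  Proof: by T18 `κ_W = L_C` iff `ρ̄/C ≠ 𝟙`; by Schaefer's formula for the ordinary `G`
(`C` = canonical subgroup `≅ μ₃ ⊗ u`, `a(φ̂) = 0`, `c = 1`): `κ_G = L_C` iff `u ≠ 1` iff `a₃(G) ≡ 2 (mod 3)`; and when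
`ρ̄/C = 𝟙` both `κ_W, κ_G` are isotropic lines `≠ L_C` of the hyperbolic plane `H¹(ℚ₃, ρ̄)` (local Tate pairing,
symmetric, `L_C` isotropic), which has exactly two isotropic lines — so `κ_W = κ_G` in both cases.
CENSUS (EVIDENCE, KUM3LOC v1.0 j132978, pre-registered P-K3', frozen scorer): KUM-EQUAL on 27 994 / 27 994 kept III* ~ good-ordinary
links (class 11: 14 425, class 12: 13 569; e.g. 7623b1 ~ 11a1, 112896o1 ~ 12544f1 of rank 2) and on 10 114 / 10 114 non-split
multiplicative links; the only 6 deviating rows are the links of 484416ej1, certified NON-congruences (cc-eng-2 rejects register,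
ℓ = 103) with non-matching line classes.
[cite: Schaefer1996, Lemma 3.8 (arXiv:1507.08324 p. 9)] [cite: PoonenRains2012, Prop. 2.9 / §4 (quadratic form on H¹(ℚ_v, E[p]))]
[evidence: census cell O5, o5-r1 GEN 5, KUM3LOC j132978: 38 108/38 108 kept links EQUAL] -/
@[conjecture] def KummerLineTransferReducibleThree : Prop :=
  ∀ (W G : WeierstrassCurve ℚ) [W.IsElliptic] [W.IsGloballyMinimal] [G.IsElliptic] [G.IsGloballyMinimal],
    ClassO5 W 3 → SubTprime W 3 → W.HasIrreducibleModPGaloisRep 3 → numStableLinesAtThree W = 1 →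
    padicValRat 3 W.Δ = 9 → IsCompanionAtThree W G → ¬ (3 ∣ G.conductorNorm ℤ) →
      ∀ x y x' y' : ℚ_[3], IsKummerBasePointThree W x y → IsKummerBasePointThree G x' y' →
        KummerTorsorsAgreeAtThree W G x x'

/-- **T18‴ `KummerLineSplitMultDifferThree` (THEOREM-CANDIDATE; the SIGNED prediction of T18 on multiplicative
companions, pre-registered P-K5 before any datum).**  For a III* O5b curve `W` with reducible `W[3]|G_{ℚ₃}` and a
SPLIT-multiplicative companion `X` at `3` (`3 ∥ N_X`, `a₃(X) = +1`; forces class 12, `ρ̄/C = 𝟙`): the Kummer torsors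
DISAGREE — `κ_W ⊄ L_C` (T18) while `κ_X = L_C` (Tate curve: `X(ℚ₃)/3 = ℚ₃ˣ/(q, cubes) ≅ im H¹(μ₃)`; equivalently
Schaefer with the Tamagawa ratio `c(X)/c(X/μ₃) = n/3n`).  For a NON-SPLIT multiplicative companion they agree
(both `= L_C`).  Consequence: Selmer transfer / visibility along a split-multiplicative congruence at `3` changes the
local condition at `3` (parity may flip); T17 is stated for GOOD companions only.
CENSUS (EVIDENCE, KUM3LOC v1.0 j132978, pre-registered P-K5, frozen scorer): KUM-DIFFERENT on 9 649 / 9 649 III* ~ split-multiplicative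
links (W `[9]` class 12 | X `[3,3,3]` | compositum `[27,27,27]`); non-split: KUM-EQUAL 10 114 / 10 114 (class 11).
[cite: Schaefer1996, Lemma 3.8 (arXiv:1507.08324 p. 9)] [cite: Silverman1994, Thm. V.5.3 (Tate curve)] [evidence: census cell O5, o5-r1 GEN 5, KUM3LOC j132978: 9 649/9 649 split DIFFERENT, 10 114/10 114 non-split EQUAL] -/
@[conjecture] def KummerLineSplitMultDifferThree : Prop :=
  ∀ (W X : WeierstrassCurve ℚ) [W.IsElliptic] [W.IsGloballyMinimal] [X.IsElliptic] [X.IsGloballyMinimal],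
    ClassO5 W 3 → SubTprime W 3 → W.HasIrreducibleModPGaloisRep 3 → numStableLinesAtThree W = 1 →
    padicValRat 3 W.Δ = 9 → IsCompanionAtThree W X → (3 ∣ X.conductorNorm ℤ) → X.LFunction 3 = 1 →
      ∀ x y x' y' : ℚ_[3], IsKummerBasePointThree W x y → IsKummerBasePointThree X x' y' →
        ¬ KummerTorsorsAgreeAtThree W X x x'

/-! ## §3 L3-irr and T17 (CONJECTURES; the residual cruxes of the visibility / Selmer-transfer line) -/

/-- **L3-irr `KummerLineTransferLocIrrThree` (crux L3 `KummerLineIsFlatThree` on the LocIrr rows, in decidable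
form; THEOREM-CANDIDATE since 2026-08-21 — follows from the written proof of T19 below ALONE: a good companion
`G` forces `W[3] ≅ G[3] ≅ V₀` globally, so FML-local is not needed (harvest-2 E88 §6.4); `@[conjecture]` tag
kept until a kernel proof).**  For a III* O5b curve `W` with `W[3]|G_{ℚ₃}` IRREDUCIBLE (24 526 of the 77 415
III* rows `N < 5·10⁵`) and a good — necessarily supersingular (`CompanionTypeLawThree`) — companion `G`: the
Kummer torsors agree, i.e. `κ_W` is the FLAT line of `ρ̄ ≅ G[3]|G_{ℚ₃}`.  (The a-priori obstruction — flat
`O_F`-models at `e = 4 > p − 1` are not unique — is bypassed by the ramification characterisation of the line.)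
Not in print as a statement (Mazur–Rubin 2012 Thm 3.1 (iv), Česnavičius 2016 Thm 1.1 exclude additive
potentially good reduction at `p`).
CENSUS (EVIDENCE, KUM3LOC P-K3', pre-registered `gen5/KUM3LOC-PREREG.md`; result `gen5/kum3loc/KUM3LOC-RESULT.md` §3):
33 155 / 33 155 kept III* `LocIrr` ~ good-supersingular links of cc-eng-2's certified congruence screen (`N < 5·10⁵`) read
KUM-EQUAL — 0 KUM-DIFFERENT (= 0 kills), 0 RHOBAR-MISMATCH; rank patterns (0,0), (0,1), (0,2), (0,3) incl. rank-0 ~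
rank-2 pairs (pilot: 20259a1 ~ 2251a1, 20691e1 ~ 2299b1, 28611f1 ~ 2023b1); 9 628 links computed twice, 0 disagreements.
[cite: MazurRubin2015SelmerCompanions, Thm. 3.1 and p. 3] [cite: Cesnavicius2016SelmerFlat, Thm. 1.1]
[evidence: census cell O5, o5-r1 GEN 5, KUM3LOC part B: 33 155/33 155 kept links EQUAL, 0 DIFFERENT] -/
@[conjecture] def KummerLineTransferLocIrrThree : Prop :=
  ∀ (W G : WeierstrassCurve ℚ) [W.IsElliptic] [W.IsGloballyMinimal] [G.IsElliptic] [G.IsGloballyMinimal],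
    ClassO5 W 3 → SubTprime W 3 → LocIrr W 3 → W.HasIrreducibleModPGaloisRep 3 →
    padicValRat 3 W.Δ = 9 → IsCompanionAtThree W G → ¬ (3 ∣ G.conductorNorm ℤ) →
      ∀ x y x' y' : ℚ_[3], IsKummerBasePointThree W x y → IsKummerBasePointThree G x' y' →
        KummerTorsorsAgreeAtThree W G x x'

/-- **Locally twin at 3**: the 3-division quartic `Ψ₃^W` is irreducible over `ℚ₃` and `Ψ₃^X` acquires a root in
the quartic field `ℚ₃[X]/(Ψ₃^W)` — the decidable shadow of "the projective mod-3 representations of `G_{ℚ₃}` on the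
four lines of `W[3]` and of `X[3]` are conjugate" (isomorphic quartic `G_{ℚ₃}`-sets of lines).  For two local `ρ̄`
of the flat supersingular inertial shape `ω₂ ⊕ ω₂³` this forces `W[3]|G_{ℚ₃} ≅ X[3]|G_{ℚ₃}`: the lifts of one
projective class are `{ρ̄, ρ̄ ⊗ u, ρ̄ ⊗ ω, ρ̄ ⊗ ωu}`, `ρ̄ ⊗ u ≅ ρ̄` (induced from `ℚ₉`), and `ρ̄ ⊗ ω` has shape
`ω₂⁵ ⊕ ω₂⁷`. [folklore] -/
def SameDivisionQuarticAtThree (W X : WeierstrassCurve ℚ) : Prop :=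
  Irreducible (W.baseChange ℚ_[3]).Ψ₃ ∧
    ∃ θ : AdjoinRoot (W.baseChange ℚ_[3]).Ψ₃, aeval θ (X.baseChange ℚ_[3]).Ψ₃ = 0

/-- **T19a `SupersingularLocalClassUniqueThree` (THEOREM — PROVED in the kernel: `Summit.BirchSwinnertonDyer.Rank1Residual.O5.supersingularLocalClassUniqueThree_holds`, file `O5/SupersingularLocalClassUniqueThreeProofs.lean`, n1011-p05 GEN 11, p320863 commit 14294cb236c6, axioms standard; tame sharpening with the `III*` clause widened to `SubTprime ∨ good`: `sameDivisionQuarticAtThree_of_subTprime_or_good`, `O5/SupersingularLocalClassUniqueThreeTame.lean`; the `@[conjecture]` tag is RETIRED by cc-typer-5 GEN 14 (cc-lead GEN 52/53 (c16)), declaration byte-identical, docstring below = o5-r1's THEOREM-CANDIDATE text of record; TARGETS §O5 G5-4).**  ONE local class: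
any two elliptic curves over `ℚ` each of which is either good supersingular at `3` or a III* O5b curve with
`Ψ₃` rootless over `ℚ₃` (= `LocIrr`, `LocalShapeTprimeThree`) are locally twin at `3` — indeed their `W[3]|G_{ℚ₃}`
are all isomorphic to ONE module `V₀ = Ind_{ℚ₉}^{ℚ₃}(ω₂ · μ₋₁)`.  Derivation (ours): the inertial shape is
`ω₂ ⊕ ω₂³` [Serre, good supersingular, `e = 1`; for III* via any good companion / `FlatMemberLawThree`], so
`ρ̄ ≅ Ind ψ` with `ψ = ω₂^{can} μ_m`; `det = ω` evaluated on `G_{ℚ₉}` gives `m² = 1` and on a Frobenius lift fixing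
`(−3)^{1/8}` gives `−m = 1`, so `m = −1`; Mackey then leaves a single class.  CENSUS (EVIDENCE, KUM3LOC): not one
RHOBAR-MISMATCH among the (III* LocIrr, good supersingular) pairs of part B, and in P-K7 every sampled III* LocIrr
curve is locally twin with EVERY one of nine unrelated small-conductor supersingular curves (`a₃ ∈ {0, ±3}`):
2 250 / 2 250 pairs (250 curves × 9), plus 300 / 300 III* curves with no congruence partner and 1 000 / 1 000 RANDOM local III*
curves in Tate form against 17a1 (P-K7d, P-K8) — every KUM-EQUAL reading certifies the module isomorphism (RESULT §0).
`SameDivisionQuarticAtThree` certifies the PROJECTIVE class only (identical for `V₀` and `V₀ ⊗ ω`); the LINEAR class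
of the III*-clause without a companion is harvest-2 E88 §6.2 (FML-local, DERIVED 2026-08-21: III* ∧ LocIrr ⟹ `V₀`,
III ∧ LocIrr ⟹ `V₀ ⊗ ω`, from the Galois twist of the formal parameter of the good model over `ℚ₃^{nr}(3^{1/4})`).
AMENDMENT 2: the LINEAR class for ALL FOUR symbols is o5-r1 GEN 6 v2 Thm 2 (`gen6/T19-PROOF-v2.md` §4, CHECKED harvest-2 E90 R5):
inertia acts by `ω₂^{1−2m}`, `m = v₃(Δ_min)/3` — good-ss/III* ↦ `V₀`, III/I₀*-ss ↦ `V₁ = V₀ ⊗ ω` (nodes T20–T22, `O5KummerLineTwisted.lean`).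
[cite: Serre1972, §1.11 Prop. 12] [evidence: census cell O5, o5-r1 GEN 5, KUM3LOC part B + P-K7/P-K7d/P-K8 (kit j133939 j133940 j134028 j134065): 0 + 0 + 0 RHOBAR-MISMATCH on III* pairs] -/
def SupersingularLocalClassUniqueThree : Prop :=
  ∀ (E E' : WeierstrassCurve ℚ) [E.IsElliptic] [E.IsGloballyMinimal] [E'.IsElliptic] [E'.IsGloballyMinimal],
    ((ClassO5 E 3 ∧ SubTprime E 3 ∧ padicValRat 3 E.Δ = 9) ∨ ¬ (3 ∣ E.conductorNorm ℤ)) →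
    ((ClassO5 E' 3 ∧ SubTprime E' 3 ∧ padicValRat 3 E'.Δ = 9) ∨ ¬ (3 ∣ E'.conductorNorm ℤ)) →
    (∀ r : ℚ_[3], ¬ ((E.baseChange ℚ_[3]).Ψ₃).IsRoot r) → (∀ r : ℚ_[3], ¬ ((E'.baseChange ℚ_[3]).Ψ₃).IsRoot r) →
      SameDivisionQuarticAtThree E E'

/-- **T19 `KummerLineUniversalThree` (the INTRINSIC form of L3-irr; TARGETS §O5 G5-4) — THEOREM-CANDIDATE since
2026-08-21: complete written proof from printed inputs = o5-r1 `gen5/T19-PROOF-SKETCH.md` §0–§4 CHECKED R1–R4 ✓ by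
harvest-2 E88 (`gen41/E88-T19-check.md` §1–§5) + E88 §6.2 (FML-local) + §6.4 (closing steps); `@[conjecture]` TAG
KEPT until a KERNEL proof (lane rule).**  Let `V₀` be the unique flat-supersingular local 3-torsion module (T19a)
and `ℓ₀ := H¹_fl(ℤ₃, 𝒢₀) ⊂ H¹(ℚ₃, V₀)` (`dim = 2`, four lines).  STATEMENT: every III* O5b curve `W` with
`W[3]|G_{ℚ₃}` irreducible has Kummer line `ℓ₀` — decidably: its Kummer torsor agrees with that of ANY good
supersingular `G`.  PROOF (paper): `L := ℚ₃(V₀) = ℚ₉(3^{1/8})`, `Gal(L/ℚ₃) = SD₁₆` of order prime to 3, so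
`H¹(ℚ₃, V₀) = Hom_G(L^×⊗𝔽₃, V₀)` and a class `c` cuts out a `V₀`-extension `M_c/L`; the cube map on the unit
filtration (`θ₀ = 1` as `ϖ⁸ = 3` [FesenkoVostokov I (5.7)–(5.8); Serre, Corps locaux XIV Prop. 9]) leaves `V₀`
in `L^×⊗𝔽₃` exactly at levels `{1, 11}` (`V₀⊗ω`: `{5, 7}`), so by reciprocity `U^{(i)} ↠ Gal^{i}` [Serre XV §2
Thm 2] and Herbrand (`ψ_{L/ℚ₃}(w) = 8w`) ONE line `ℓ*` has `ℚ₃`-upper break `1/8`, the other three `11/8`.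
Fontaine's Théorème A in Serre numbering — `G_K^{v} = 1` on a finite flat `O_K`-group scheme killed by `p^n` for
`v > e(K)(n + 1/(p−1)) − 1`, ANY `e` [Fontaine1985 Thm A; restated with the numbering shift `G^{(m)} = G^{m−1}` in
Yoshida arXiv:0905.1171 p. 3 and Hattori arXiv:0801.2149 p. 3] — applied to the torsor-generated scheme
`Γ = ⨆ₖ [3]⁻¹(kP̃)` (finite flat, `3Γ = 0`, `ℚ₃(Γ) = M_c`; E88 §2) over `ℤ₃` for good `G` (breaks `≤ 1/2`) and over
`O_K`, `K = ℚ₃(3^{1/4})`, for `W` (tame `e = 4` ⟹ good over `K`; `K`-breaks `≤ 5 < 11/2`) gives `κ_G = κ_W = ℓ*`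
(margin `1/2`; the different form of Thm A would NOT suffice: `105/18 < 6`).  The binders certify `W[3] ≅ V₀`
by FML-local (E88 §6.2, DERIVED): on the good model over `ℚ₃^{nr}(3^{1/4})` the Galois twist of the formal
parameter is `t(gP) = (g(ϖ)/ϖ)^{±1}·g(t(P))` (`+` III*, `−` III); `LocIrr ⟺` no canonical subgroup (Katz–Lubin)
⟹ all eight 3-torsion parameters have `v₃ = 1/8` and their leading terms give `W[3]|_I = {ω₂, ω₂³} = V₀`
(III*) resp. `{ω₂⁵, ω₂⁷} = V₀⊗ω` (III).  Numerical shadow: the P-K10 torsor discriminant `d3 = 8 + s ∈ {9, 15}`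
(`O5/O5TorsorDiscriminant.lean`).  Not in print as a statement [Mazur–Rubin / Česnavičius exclude additive
potentially good at `p`; CDT 1999 §4–5 / Savitt 2005 is bypassed].
CENSUS (EVIDENCE, pre-registered P-K7 / P-K7d / P-K8, KUM3LOC Addenda 5–7; `gen5/kum3loc/KUM3LOC-RESULT.md` §5): against
UNRELATED supersingular curves the Kummer torsors agree on 2 250 / 2 250 (linked III* × panel of 9), 300 / 300 (unlinked III* ×
17a1) and 1 000 / 1 000 (random local III* × 17a1) pairs — 0 KUM-DIFFERENT; the 550 type-III (`V₀ ⊗ ω`) control pairs never agree.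
[cite: Fontaine1985, Thm. A] [cite: Yoshida2009, p. 3] [cite: Hattori2008, p. 3] [cite: Serre1979, Ch. XIV §4 Prop. 9, Ch. XV §2 Thm. 2, Ch. IV §3]
[cite: ConradDiamondTaylor1999, §4–5] [cite: Savitt2005, Thm. 1.2 / §3] [evidence: census cell O5, o5-r1 GEN 5, KUM3LOC P-K7/P-K7d/P-K8 (kit j133939 j133940 j134028 j134065) + part B (33 155/33 155 kept links)] -/
@[conjecture] def KummerLineUniversalThree : Prop :=
  ∀ (W G : WeierstrassCurve ℚ) [W.IsElliptic] [W.IsGloballyMinimal] [G.IsElliptic] [G.IsGloballyMinimal],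
    ClassO5 W 3 → SubTprime W 3 → LocIrr W 3 → padicValRat 3 W.Δ = 9 →
    ¬ (3 ∣ G.conductorNorm ℤ) → (∀ r : ℚ_[3], ¬ ((G.baseChange ℚ_[3]).Ψ₃).IsRoot r) →
      ∀ x y x' y' : ℚ_[3], IsKummerBasePointThree W x y → IsKummerBasePointThree G x' y' →
        KummerTorsorsAgreeAtThree W G x x'

/-- **T17 `CleanSelmerTransferThree` (CONJECTURE; TARGETS §O5 G4-8 (b)).**  For a III* O5b curve `W` with
irreducible `ρ̄_{W,3}`, a GOOD companion `G` at `3`, and a CLEAN pair — `H⁰(ℚ_ℓ, ρ̄) = 0` at every prime `ℓ ≠ 3`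
of `N_W N_G` (so `H¹(ℚ_ℓ, ρ̄) = 0` there and the two mod-3 Selmer groups inside `H¹(ℚ, ρ̄)` differ at most in the
local condition at `3`) — the 3-Selmer groups have the same order.  T17 ⟸ (L3 = T18″ on reducible rows, proved;
`KummerLineTransferLocIrrThree` on LocIrr rows) + the clean-local lemma + `selmerGroup_eq_of_algHom`-type transport.
USE (o5-r2's visibility side, per row): with a clean RANK-2 companion, `#Sel₃(W) ≥ 9` descent-free, and Kato's
additive rank-0 bound closes `BSD₃(W)` for the 123 'r2-clean' III* curves of G4-8 (all 135 links of the 36 webs EXACTLY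
certified `W[3] ≅ G[3]` by cc-eng-2's X3E, 2026-08-21).  CENSUS (EVIDENCE): BSD-shadow on
2 158 / 2 158 clean pairs (G4-8 (b)); BSD-free test = ask A-O5-S2 (sel3ct, cc-eng-4; predictions frozen in
`gen4/sel3ct-A-O5-S2/README.md`).  Why it might fail: only through L3-irr (the reducible case is T18″).
TREE FACTS FOR THE ASSEMBLY (harvest-2 GEN 39, E86 — added at landing at o5-r1's request; import, do not restate):
the local condition `κ_W` IS the tree's `WeierstrassCurve.kummerLocalConditionAt W 3 ℚ_[3]`, with its order for ANY
reduction type (`Literature/NumberTheory/EllipticCurves/LocalKummerMap.lean`, `natCard_kummerLocalConditionAt_adicCompletion`);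
Kummer images are isotropic for the Weil cup product (PROVED, `KummerImageIsotropyProofs.lean`,
`kummerClass_cupProduct_kummerClass_eq_zero_holds`) and maximal isotropic / their own annihilator modulo the local
Euler-characteristic count (`LocalTateDualityOrderForE.lean`, `forall_mem_kummerLocalConditionAt_weilCupProduct_eq_zero_iff_of_eulerChar`;
`LocalEulerCharacteristicTorsion.lean`, `…_iff_of_localEuler`); the parity comparison of two self-dual Selmer structures
differing at one place — KMR §3 Thm. 3.9 = Mazur–Rubin 2007 Thm. 1.4 at odd `p` — is PROVED on abstract data
(`QuadraticSelmerStructure.lean`: `QuadraticSelmerStructure.finrank_selmerGroup_sub_modEq`,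
`even_finrank_selmerGroup_add_sum`; input `IsSelfDualAt` ⇐ the Poitou–Tate named fact `poitouTate_selmerStructure_duality`
of `GaloisCohomology/PoitouTateSelmerStructures.lean`); `p`-parity = `Literature.NumberTheory.EllipticCurves.p_parity` /
`selmerCorank_mod_two_eq` (`BSDSelmer.lean`, Dokchitser–Dokchitser 2010, with the `…Proofs` derivations); and Mazur–Rubin
2007 Prop. 2.1 (Cassels–Tate alone: `dim Sel₃ ≡ r + dim E(ℚ)[3] (mod 2)`) makes the CLEAN-pair parity test of G4-8 /
E86 §3.5 unconditional.  E86's verdict on L3 itself: NOT IN PRINT (Poonen–Rains 2012 Prop. 4.12 = good reduction;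
Mazur–Rubin 2015 Rem. 5.9 / Česnavičius 2016 §2 stop at semiabelian reduction at `v ∣ p`).
[cite: MazurRubin2015SelmerCompanions, Thm. 3.1] [evidence: census cell O5, o5-r1 GEN 4 G4-8: 2 158/2 158 BSD-shadow; A-O5-S2 GRH 3-descent (cc-eng-4, two engines): dim Sel₃ as pre-registered on 291/293 rows + 2 within the allowed set, 0 deviations] -/
@[conjecture] def CleanSelmerTransferThree : Prop :=
  ∀ (W G : WeierstrassCurve ℚ) [W.IsElliptic] [W.IsGloballyMinimal] [G.IsElliptic] [G.IsGloballyMinimal],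
    ClassO5 W 3 → SubTprime W 3 → W.HasIrreducibleModPGaloisRep 3 → padicValRat 3 W.Δ = 9 →
    IsCompanionAtThree W G → ¬ (3 ∣ G.conductorNorm ℤ) →
    (∀ (ℓ : ℕ) (hℓ : ℓ.Prime), ℓ ≠ 3 → (ℓ : ℤ) ∣ W.conductorNorm ℤ * G.conductorNorm ℤ →
        @NoLocalThreeTorsionAt W ℓ ⟨hℓ⟩) →
      Nat.card (W.selmerGroup 3) = Nat.card (G.selmerGroup 3)

/-! ## §4 Links (PROVED bookkeeping) -/

/-- The reducible half of T17-local is T18″ and the irreducible half is L3-irr: together they give T17-local for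
every III* O5b curve with big image and a good companion (case split on `numStableLinesAtThree W ∈ {0, 1}` by
`NonSplitAtThreeLaw` and `LocalShapeTprimeThree`). [folklore] -/
theorem kummerTorsorsAgree_of_cases
    (hshape : LocalShapeTprimeThree) (hns : NonSplitAtThreeLaw)
    (hred : KummerLineTransferReducibleThree) (hirr : KummerLineTransferLocIrrThree)
    (W G : WeierstrassCurve ℚ) [W.IsElliptic] [W.IsGloballyMinimal] [G.IsElliptic] [G.IsGloballyMinimal]
    (h5 : ClassO5 W 3) (ht : SubTprime W 3) (hbig : W.HasIrreducibleModPGaloisRep 3)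
    (h9 : padicValRat 3 W.Δ = 9) (hc : IsCompanionAtThree W G) (hg : ¬ (3 ∣ G.conductorNorm ℤ))
    (x y x' y' : ℚ_[3]) (hP : IsKummerBasePointThree W x y) (hP' : IsKummerBasePointThree G x' y') :
    KummerTorsorsAgreeAtThree W G x x' := by
  by_cases hL : LocIrr W 3
  · exact hirr W G h5 ht hL hbig h9 hc hg x y x' y' hP hP'
  · have h0 : numStableLinesAtThree W ≠ 0 := fun h => hL ((hshape W h5 ht).mpr h)
    have h1 : numStableLinesAtThree W ≤ 1 := hns W h5 ht
    have : numStableLinesAtThree W = 1 := by omega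
    exact hred W G h5 ht hbig this h9 hc hg x y x' y' hP hP'


/-! ## §5 Kernel-checked linear algebra behind T18 (PROVED by `decide`; no axioms, no `native_decide`) -/

/-- The binary quadratic form `Q_{a,b,c}(x,y) = a x² + 2 b x y + c y²` over `𝔽₃` (Gram matrix `[[a,b],[b,c]]`,
non-degenerate iff `a c − b² ≠ 0`).  In T18 it is the local Tate pairing on `H¹(ℚ₃, W[3]) ≅ 𝔽₃²`
(symmetric for the Weil pairing of an elliptic curve, non-degenerate by local duality). [folklore] -/
abbrev tateFormThree (a b c : ZMod 3) (v : ZMod 3 × ZMod 3) : ZMod 3 :=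
  a * v.1 * v.1 + 2 * b * v.1 * v.2 + c * v.2 * v.2

set_option synthInstance.maxHeartbeats 400000 in
set_option synthInstance.maxSize 4096 in
/-- **Two isotropic lines (PROVED, kernel `decide` over all `3³ · 9³` cases).**  For a non-degenerate symmetric
bilinear form on `𝔽₃²`: if `u ≠ 0` is isotropic and `v`, `w` are isotropic vectors off the line `𝔽₃ u`, then `w ∈ 𝔽₃ v`.
This is the step of T18 that forces `κ_G = κ_W` for EVERY companion `G` that is good ordinary or non-split
multiplicative at `3`: `u` spans `L_C` (isotropic), `κ_W` and `κ_G` are maximal isotropic (local Tate duality of the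
Kummer image) and both `≠ L_C` in line class 12 — hence equal; in class 11 both equal `L_C`. [folklore] -/
theorem isotropicLine_unique_off_line :
    ∀ (a b c : ZMod 3) (u v w : ZMod 3 × ZMod 3),
      (a * c - b * b ≠ 0 ∧ u ≠ 0 ∧ tateFormThree a b c u = 0 ∧ tateFormThree a b c v = 0 ∧
        tateFormThree a b c w = 0 ∧ (∀ t : ZMod 3, v ≠ t • u) ∧ (∀ t : ZMod 3, w ≠ t • u)) →
      ∃ t : ZMod 3, w = t • v := by
  decide

/-- **Isotropic count (PROVED, kernel `decide`).**  A non-degenerate symmetric form on `𝔽₃²` has `0` or exactly `4`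
non-zero isotropic vectors (no isotropic line, or exactly two).  With `L_C` isotropic (T18 (c)) the second case holds,
so the Kummer line of ANY curve with this local `ρ̄` is one of exactly two lines — the dichotomy `[3,6]` (class 11) /
`[9]` (class 12) of `KUM3LOC` P-K1'. [folklore] -/
theorem isotropic_card_zero_or_four (a b c : ZMod 3) (hdet : a * c - b * b ≠ 0) :
    (Finset.univ.filter (fun v : ZMod 3 × ZMod 3 => v ≠ 0 ∧ tateFormThree a b c v = 0)).card = 0 ∨
    (Finset.univ.filter (fun v : ZMod 3 × ZMod 3 => v ≠ 0 ∧ tateFormThree a b c v = 0)).card = 4 := by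
  revert a b c; decide

end Summit.BirchSwinnertonDyer.Rank1Residual.O5
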